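import Mathlib.RepresentationTheory.Homological.GroupCohomology.Functoriality
import HarnessLib

/-!
# Semilinear functoriality of group cohomology in the coefficients

For a group `G`, commutative rings `k`, `k'`, a ring homomorphism `σ : k → k'`, a `k`-linear
representation `A` and a `k'`-linear representation `B` of `G`, every ADDITIVE map `s : A → B` that
is `σ`-semilinear (`s (c • a) = σ c • s a`) and `G`-equivariant (`s (g • a) = g • s a`) acts on the
standard (inhomogeneous) cochains `C^n(G, A) = Fun(G^n, A)` by post-composition, commutes with the
coboundary `(δf)(g_0, …, g_n) = g_0 f(g_1, …, g_n) + ∑ (−1)^{j+1} f(…, g_j g_{j+1}, …) +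
(−1)^{n+1} f(g_0, …, g_{n−1})` (Brown, *Cohomology of Groups*, III.1 Example 3: the standard cochain
complex; the coboundary only uses the `G`-action and the additive structure of the coefficients),
and therefore induces a `σ`-SEMILINEAR map `Hⁿ(s) : Hⁿ(G, A) → Hⁿ(G, B)` on Mathlib's
`groupCohomology`, `[z] ↦ [s ∘ z]`, functorial in `s` and natural with respect to Mathlib's
`k`-linear functoriality `groupCohomology.map` in the coefficients.

Two instances matter downstream:
* `σ = (k → k')` a change of coefficient ring and `s = (a ↦ 1 ⊗ a)`-type maps (comparison of
  `Hⁿ(Γ, V)` and `Hⁿ(Γ, V ⊗_k k')`);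
* `k = k' = ℂ`, `σ ∈ Aut(ℂ)` and `s = 1 ⊗ σ` on `V_E ⊗_E ℂ` for a representation `V_E` defined
  over a number field `E`: the `σ`-semilinear action of `Aut(ℂ/E)` on the cohomology of an
  arithmetic group with algebraic coefficients, commuting with the Hecke operators (which are
  instances of `groupCohomology.map`), as used in Clozel's proof that the Hecke field of a regular
  algebraic cuspidal representation is a number field (Clozel 1990, proof of Thm. 3.13, §3.5) — this
  file supplies the formal input "(4) the `σ`-semilinear functoriality of group cohomology in the
  coefficient module" listed in `Literature/NumberTheory/Automorphic/ClozelAlgebraicityHeckeFieldSymmetryProofs.lean`.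

## Main definitions and results (all proved; Mathlib only)

* `cochainsSemimap s n : C^n(G, A) →ₛₗ[σ] C^n(G, B)`, `f ↦ s ∘ f`; `d_cochainsSemimap`
  (`δ (s ∘ f) = s ∘ δ f`, needs `G`-equivariance of `s`).
* `cocyclesSemimap s hs n : Z^n(G, A) →ₛₗ[σ] Z^n(G, B)` (Mathlib `groupCohomology.cocycles`).
* `semimap s hs n : Hⁿ(G, A) →ₛₗ[σ] Hⁿ(G, B)` with `semimap_π` (`Hⁿ(s)[z] = [s ∘ z]`),
  `semimap_eq_self` (identity), `semimap_semimap` (composition), `semimap_injective_of_leftInverse`,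
  and `semimap_map` (naturality: `Hⁿ(s₂) ∘ Hⁿ(φ) = Hⁿ(ψ) ∘ Hⁿ(s)` whenever `s₂ ∘ φ = ψ ∘ s` for
  `k`-linear `φ`, `k'`-linear `ψ`).
* Glue for Mathlib's `groupCohomology` in arbitrary degree: `π_apply_eq_zero_iff` (`[z] = 0` iff `z`
  is a coboundary), `iCocycles_injective`, `d_iCocycles`.

## References

* K. S. Brown, *Cohomology of Groups*, GTM 87, Springer 1982, III.1 Example 3 (the standard cochain
  complex `C^*(G, M)`, functions `G^n → M`, and its coboundary). [Brown1982CohomologyGroups]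
* L. Clozel, *Motifs et formes automorphes: applications du principe de fonctorialité*, in:
  Automorphic forms, Shimura varieties, and L-functions I (Ann Arbor 1988), Academic Press 1990,
  Thm. 3.13 and its proof (§3.5). [Clozel1990]
-/

noncomputable section

open CategoryTheory groupCohomology

namespace Literature.Algebra.Homology

universe u

variable {k k' : Type u} [CommRing k] [CommRing k'] {G : Type u} [Group G]

/-! ### Glue for Mathlib's `groupCohomology` in arbitrary degree -/

section Glue

variable (A : Rep k G)

/-- `iCocycles : Zⁿ(G, A) → Cⁿ(G, A)` is injective (it is a kernel inclusion). [folklore] -/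
theorem iCocycles_injective (n : ℕ) : Function.Injective (iCocycles A n) :=
  (ModuleCat.mono_iff_injective (iCocycles A n)).1 inferInstance

/-- `δ z = 0` for a cocycle `z`, for Mathlib's inhomogeneous coboundary `inhomogeneousCochains.d`.
[cite: Brown1982CohomologyGroups, III.1 Example 3 (standard cochain complex)] -/
theorem d_iCocycles (n : ℕ) (z : cocycles A n) :
    inhomogeneousCochains.d A n (iCocycles A n z) = 0 := by
  have h := congrArg ModuleCat.Hom.hom ((inhomogeneousCochains A).iCycles_d n (n + 1))
  have h' := LinearMap.congr_fun h z
  rw [ModuleCat.hom_comp, LinearMap.comp_apply, ModuleCat.hom_zero, LinearMap.zero_apply,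
    inhomogeneousCochains.d_def] at h'
  exact h'

/-- `π : Zⁿ(G, A) → Hⁿ(G, A)` is surjective. [folklore] -/
theorem π_surjective (n : ℕ) : Function.Surjective (groupCohomology.π A n) :=
  fun x => groupCohomology_induction_on x fun z => ⟨z, rfl⟩

/-- `i (δ w) = d w`: the cocycle `toCocycles A i j w` has underlying cochain `d w` (Mathlib
`toCycles_i`, pointwise). [folklore] -/
theorem iCocycles_toCocycles (i j : ℕ) (w : (inhomogeneousCochains A).X i) :
    iCocycles A j (toCocycles A i j w) = (inhomogeneousCochains A).d i j w := by
  have h := LinearMap.congr_fun (congrArg ModuleCat.Hom.hom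
    ((inhomogeneousCochains A).toCycles_i i j)) w
  rw [ModuleCat.hom_comp, LinearMap.comp_apply] at h
  exact h

/-- `[δ w] = 0` in `Hⁿ(G, A)` (Mathlib `toCycles_comp_homologyπ`, pointwise). [folklore] -/
theorem π_toCocycles (i j : ℕ) (w : (inhomogeneousCochains A).X i) :
    groupCohomology.π A j (toCocycles A i j w) = 0 := by
  have h := LinearMap.congr_fun
    (congrArg ModuleCat.Hom.hom ((inhomogeneousCochains A).toCycles_comp_homologyπ i j)) w
  rw [ModuleCat.hom_comp, ModuleCat.hom_zero, LinearMap.comp_apply, LinearMap.zero_apply] at h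
  exact h

/-- **`[z] = 0` in `Hⁿ(G, A)` iff `z = δ w` for a cochain `w` of degree `n − 1`** (`Hⁿ` is the
cokernel of `C^{n−1} → Zⁿ`; for `n = 0` the map `toCocycles A (0 - 1) 0` is zero and the statement
reads `[z] = 0 ↔ z = 0`). [cite: Brown1982CohomologyGroups, III.1 Example 3 (standard cochain complex)] -/
theorem π_apply_eq_zero_iff (n : ℕ) (z : cocycles A n) :
    groupCohomology.π A n z = 0 ↔
      ∃ w : (inhomogeneousCochains A).X (n - 1), toCocycles A (n - 1) n w = z := by
  have hprev : (ComplexShape.up ℕ).prev n = n - 1 := by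
    cases n with
    | zero => exact CochainComplex.prev_nat_zero
    | succ n => exact CochainComplex.prev_nat_succ n
  have hex : (ShortComplex.mk ((inhomogeneousCochains A).toCycles (n - 1) n)
      ((inhomogeneousCochains A).homologyπ n)
      ((inhomogeneousCochains A).toCycles_comp_homologyπ (n - 1) n)).Exact :=
    ShortComplex.exact_of_g_is_cokernel _
      ((inhomogeneousCochains A).homologyIsCokernel (n - 1) n hprev)
  rw [ShortComplex.moduleCat_exact_iff] at hex
  constructor
  · intro hz
    exact hex z hz
  · rintro ⟨w, rfl⟩
    exact π_toCocycles A (n - 1) n w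

/-- Two cocycles have the same class iff they differ by a coboundary. [folklore] -/
theorem π_apply_eq_π_apply_iff (n : ℕ) (z z' : cocycles A n) :
    groupCohomology.π A n z = groupCohomology.π A n z' ↔
      ∃ w : (inhomogeneousCochains A).X (n - 1), toCocycles A (n - 1) n w = z - z' := by
  rw [← sub_eq_zero, ← map_sub, π_apply_eq_zero_iff]

end Glue

/-! ### Semilinear maps of coefficients act on cochains and commute with the coboundary -/

section Cochains

variable {σ : k →+* k'} {A : Rep k G} {B : Rep k' G}

/-- Post-composition of standard cochains `G^n → A` with a `σ`-semilinear map of coefficients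
`s : A → B`, as a `σ`-semilinear map `C^n(G, A) → C^n(G, B)`.
[cite: Brown1982CohomologyGroups, III.1 Example 3 (standard cochain complex)] -/
def cochainsSemimap (s : A.V →ₛₗ[σ] B.V) (n : ℕ) :
    ((Fin n → G) → A.V) →ₛₗ[σ] ((Fin n → G) → B.V) where
  toFun f := fun g => s (f g)
  map_add' f f' := by
    funext g
    simp
  map_smul' c f := by
    funext g
    simp [map_smulₛₗ]

/-- Unfolding lemma: `(s_* f)(g) = s (f g)`. [folklore] -/
@[simp]
theorem cochainsSemimap_apply (s : A.V →ₛₗ[σ] B.V) (n : ℕ) (f : (Fin n → G) → A.V)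
    (g : Fin n → G) : cochainsSemimap s n f g = s (f g) :=
  rfl

/-- **`δ (s ∘ f) = s ∘ δ f`**: post-composition with an additive `G`-equivariant map of coefficients
commutes with the standard coboundary
`(δf)(g) = g_0 f(g_1, …) + ∑_j (−1)^{j+1} f(…, g_j g_{j+1}, …)` (the coboundary only involves the
`G`-action, sums and signs). [cite: Brown1982CohomologyGroups, III.1 Example 3 (standard cochain complex)] -/
theorem d_cochainsSemimap (s : A.V →ₛₗ[σ] B.V) (hs : ∀ (g : G) (a : A.V), s (A.ρ g a) = B.ρ g (s a))
    (n : ℕ) (f : (Fin n → G) → A.V) :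
    inhomogeneousCochains.d B n (cochainsSemimap s n f) =
      cochainsSemimap s (n + 1) (inhomogeneousCochains.d A n f) := by
  funext g
  rw [cochainsSemimap_apply, inhomogeneousCochains.d_hom_apply, inhomogeneousCochains.d_hom_apply,
    map_add, map_sum, hs]
  congr 1
  refine Finset.sum_congr rfl fun j _ => ?_
  rw [map_smulₛₗ, map_pow, map_neg, map_one, cochainsSemimap_apply]

/-- `s_*` commutes with the differentials of Mathlib's complex of inhomogeneous cochains in all
bidegrees (zero off the diagonal `j = i + 1`). [folklore] -/
theorem cochainsSemimap_d (s : A.V →ₛₗ[σ] B.V) (hs : ∀ (g : G) (a : A.V), s (A.ρ g a) = B.ρ g (s a))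
    (i j : ℕ) (w : (inhomogeneousCochains A).X i) :
    cochainsSemimap s j ((inhomogeneousCochains A).d i j w) =
      (inhomogeneousCochains B).d i j (cochainsSemimap s i w) := by
  by_cases hij : i + 1 = j
  · subst hij
    rw [inhomogeneousCochains.d_def, inhomogeneousCochains.d_def]
    exact (d_cochainsSemimap s hs i w).symm
  · rw [(inhomogeneousCochains A).shape i j hij, (inhomogeneousCochains B).shape i j hij]
    change cochainsSemimap s j 0 = 0
    exact map_zero _

end Cochains

/-! ### Cocycles -/

section Cocycles

variable {σ : k →+* k'} {A : Rep k G} {B : Rep k' G}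

/-- `δ (s ∘ z) = 0` for a cocycle `z`. [folklore] -/
theorem d_cochainsSemimap_iCocycles (s : A.V →ₛₗ[σ] B.V)
    (hs : ∀ (g : G) (a : A.V), s (A.ρ g a) = B.ρ g (s a)) (n : ℕ) (z : cocycles A n) :
    inhomogeneousCochains.d B n (cochainsSemimap s n (iCocycles A n z)) = 0 := by
  rw [d_cochainsSemimap s hs, d_iCocycles, map_zero]

/-- **`s_*` on cocycles**: the `σ`-semilinear map `Zⁿ(G, A) → Zⁿ(G, B)`, `z ↦ s ∘ z`.
[cite: Brown1982CohomologyGroups, III.1 Example 3 (standard cochain complex)] -/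
def cocyclesSemimap (s : A.V →ₛₗ[σ] B.V) (hs : ∀ (g : G) (a : A.V), s (A.ρ g a) = B.ρ g (s a))
    (n : ℕ) : cocycles A n →ₛₗ[σ] cocycles B n where
  toFun z := cocyclesMk (cochainsSemimap s n (iCocycles A n z)) (d_cochainsSemimap_iCocycles s hs n z)
  map_add' z z' := by
    refine iCocycles_injective B n ?_
    refine (iCocycles_mk _ (d_cochainsSemimap_iCocycles s hs n (z + z'))).trans ?_
    refine Eq.trans ?_ (map_add (ConcreteCategory.hom (iCocycles B n)) _ _).symm
    refine Eq.trans ?_ (congrArg₂ (· + ·) (iCocycles_mk _ (d_cochainsSemimap_iCocycles s hs n z))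
      (iCocycles_mk _ (d_cochainsSemimap_iCocycles s hs n z'))).symm
    simp only [map_add]
  map_smul' c z := by
    refine iCocycles_injective B n ?_
    refine (iCocycles_mk _ (d_cochainsSemimap_iCocycles s hs n (c • z))).trans ?_
    refine Eq.trans ?_ (map_smul (ConcreteCategory.hom (iCocycles B n)) _ _).symm
    refine Eq.trans ?_
      (congrArg (σ c • ·) (iCocycles_mk _ (d_cochainsSemimap_iCocycles s hs n z))).symm
    simp only [map_smul, map_smulₛₗ]

/-- The cochain underlying `s_* z` is `s ∘ z`. [folklore] -/
@[simp]
theorem iCocycles_cocyclesSemimap (s : A.V →ₛₗ[σ] B.V)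
    (hs : ∀ (g : G) (a : A.V), s (A.ρ g a) = B.ρ g (s a)) (n : ℕ) (z : cocycles A n) :
    iCocycles B n (cocyclesSemimap s hs n z) = cochainsSemimap s n (iCocycles A n z) :=
  iCocycles_mk (cochainsSemimap s n (iCocycles A n z)) (d_cochainsSemimap_iCocycles s hs n z)

/-- `s_* (δ w) = δ (s ∘ w)` on cocycles. [folklore] -/
theorem cocyclesSemimap_toCocycles (s : A.V →ₛₗ[σ] B.V)
    (hs : ∀ (g : G) (a : A.V), s (A.ρ g a) = B.ρ g (s a)) (i n : ℕ)
    (w : (inhomogeneousCochains A).X i) :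
    cocyclesSemimap s hs n (toCocycles A i n w) = toCocycles B i n (cochainsSemimap s i w) := by
  refine iCocycles_injective B n ?_
  rw [iCocycles_cocyclesSemimap, iCocycles_toCocycles, iCocycles_toCocycles, cochainsSemimap_d s hs]

/-- `s_*` respects cohomology classes. [folklore] -/
theorem π_cocyclesSemimap_eq_of_π_eq (s : A.V →ₛₗ[σ] B.V)
    (hs : ∀ (g : G) (a : A.V), s (A.ρ g a) = B.ρ g (s a)) (n : ℕ) {z z' : cocycles A n}
    (h : groupCohomology.π A n z = groupCohomology.π A n z') :
    groupCohomology.π B n (cocyclesSemimap s hs n z) =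
      groupCohomology.π B n (cocyclesSemimap s hs n z') := by
  obtain ⟨w, hw⟩ := (π_apply_eq_π_apply_iff A n z z').1 h
  refine (π_apply_eq_π_apply_iff B n _ _).2 ⟨cochainsSemimap s (n - 1) w, ?_⟩
  rw [← cocyclesSemimap_toCocycles s hs, hw, map_sub]

end Cocycles

/-! ### Cohomology -/

section Cohomology

variable {σ : k →+* k'} {A : Rep k G} {B : Rep k' G}

/-- `Hⁿ(s)` on classes, through a chosen representing cocycle. [folklore] -/
def semimapFun (s : A.V →ₛₗ[σ] B.V) (hs : ∀ (g : G) (a : A.V), s (A.ρ g a) = B.ρ g (s a))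
    (n : ℕ) (x : groupCohomology A n) : groupCohomology B n :=
  groupCohomology.π B n (cocyclesSemimap s hs n (Classical.choose (π_surjective A n x)))

/-- `Hⁿ(s) [z] = [s ∘ z]` for the auxiliary `semimapFun`. [folklore] -/
theorem semimapFun_π (s : A.V →ₛₗ[σ] B.V) (hs : ∀ (g : G) (a : A.V), s (A.ρ g a) = B.ρ g (s a))
    (n : ℕ) (z : cocycles A n) :
    semimapFun s hs n (groupCohomology.π A n z) = groupCohomology.π B n (cocyclesSemimap s hs n z) :=
  π_cocyclesSemimap_eq_of_π_eq s hs n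
    (Classical.choose_spec (π_surjective A n (groupCohomology.π A n z)))

/-- **Semilinear functoriality of group cohomology in the coefficients.** For a ring homomorphism
`σ : k → k'` and an additive, `σ`-semilinear, `G`-equivariant map `s : A → B` from a `k`-linear to a
`k'`-linear representation of `G`, the induced `σ`-semilinear map `Hⁿ(s) : Hⁿ(G, A) → Hⁿ(G, B)`,
`[z] ↦ [s ∘ z]`, on Mathlib's `groupCohomology` (well defined by `d_cochainsSemimap`). For `σ = id`
this is the usual functoriality of `Hⁿ(G, −)` in the coefficient module (Brown III.1; Mathlib
`groupCohomology.map (MonoidHom.id G)`), for `σ ∈ Aut(ℂ)` the semilinear `Aut(ℂ)`-action on the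
cohomology of arithmetic groups used by Clozel (1990, §3.5).
[cite: Brown1982CohomologyGroups, III.1 Example 3 (standard cochain complex)]
[cite: Clozel1990, Thm. 3.13 (proof, §3.5)] -/
def semimap (s : A.V →ₛₗ[σ] B.V) (hs : ∀ (g : G) (a : A.V), s (A.ρ g a) = B.ρ g (s a)) (n : ℕ) :
    groupCohomology A n →ₛₗ[σ] groupCohomology B n where
  toFun := semimapFun s hs n
  map_add' x y := by
    induction x using groupCohomology_induction_on with
    | h z =>
      induction y using groupCohomology_induction_on with
      | h z' =>
        rw [← map_add, semimapFun_π, semimapFun_π, semimapFun_π, map_add, map_add]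
  map_smul' c x := by
    induction x using groupCohomology_induction_on with
    | h z =>
      rw [← map_smul, semimapFun_π, semimapFun_π, map_smulₛₗ, map_smul]

/-- **`Hⁿ(s) [z] = [s ∘ z]`.** [cite: Brown1982CohomologyGroups, III.1 Example 3 (standard cochain complex)] -/
@[simp]
theorem semimap_π (s : A.V →ₛₗ[σ] B.V) (hs : ∀ (g : G) (a : A.V), s (A.ρ g a) = B.ρ g (s a))
    (n : ℕ) (z : cocycles A n) :
    semimap s hs n (groupCohomology.π A n z) = groupCohomology.π B n (cocyclesSemimap s hs n z) :=
  semimapFun_π s hs n z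

/-- `Hⁿ(s)` only depends on the underlying function of `s` (two semilinear structures on the same
additive map give the same map in cohomology; in particular the choice of `σ` is immaterial).
[folklore] -/
theorem semimap_congr {σ' : k →+* k'} (s : A.V →ₛₗ[σ] B.V)
    (hs : ∀ (g : G) (a : A.V), s (A.ρ g a) = B.ρ g (s a)) (s' : A.V →ₛₗ[σ'] B.V)
    (hs' : ∀ (g : G) (a : A.V), s' (A.ρ g a) = B.ρ g (s' a)) (h : ∀ a, s a = s' a) (n : ℕ)
    (x : groupCohomology A n) : semimap s hs n x = semimap s' hs' n x := by
  induction x using groupCohomology_induction_on with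
  | h z =>
    rw [semimap_π, semimap_π]
    congr 1
    refine iCocycles_injective B n ?_
    rw [iCocycles_cocyclesSemimap, iCocycles_cocyclesSemimap]
    funext g
    rw [cochainsSemimap_apply, cochainsSemimap_apply, h]

/-- **Identity**: if `s` is the identity map of `A` (for any `σ : k → k` making it semilinear, e.g.
`σ = id`), then `Hⁿ(s) = id`. [folklore] -/
theorem semimap_eq_self {τ : k →+* k} (s : A.V →ₛₗ[τ] A.V)
    (hs : ∀ (g : G) (a : A.V), s (A.ρ g a) = A.ρ g (s a)) (h : ∀ a, s a = a) (n : ℕ)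
    (x : groupCohomology A n) : semimap s hs n x = x := by
  induction x using groupCohomology_induction_on with
  | h z =>
    rw [semimap_π]
    congr 1
    refine iCocycles_injective A n ?_
    rw [iCocycles_cocyclesSemimap]
    funext g
    rw [cochainsSemimap_apply, h]

/-- **Composition**: `Hⁿ(t) = Hⁿ(s') ∘ Hⁿ(s)` whenever `t = s' ∘ s` as functions (for a third
ring `k''`, `σ' : k' → k''` and any `τ : k → k''` making `t` semilinear). [folklore] -/
theorem semimap_semimap {k'' : Type u} [CommRing k''] {σ' : k' →+* k''} {τ : k →+* k''}
    {C : Rep k'' G} (s : A.V →ₛₗ[σ] B.V) (hs : ∀ (g : G) (a : A.V), s (A.ρ g a) = B.ρ g (s a))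
    (s' : B.V →ₛₗ[σ'] C.V) (hs' : ∀ (g : G) (b : B.V), s' (B.ρ g b) = C.ρ g (s' b))
    (t : A.V →ₛₗ[τ] C.V) (ht : ∀ (g : G) (a : A.V), t (A.ρ g a) = C.ρ g (t a))
    (h : ∀ a, t a = s' (s a)) (n : ℕ) (x : groupCohomology A n) :
    semimap s' hs' n (semimap s hs n x) = semimap t ht n x := by
  induction x using groupCohomology_induction_on with
  | h z =>
    rw [semimap_π, semimap_π, semimap_π]
    congr 1
    refine iCocycles_injective C n ?_
    rw [iCocycles_cocyclesSemimap, iCocycles_cocyclesSemimap, iCocycles_cocyclesSemimap]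
    funext g
    rw [cochainsSemimap_apply, cochainsSemimap_apply, cochainsSemimap_apply, h]

/-- **Left inverses**: if `s' ∘ s = id` on `A` then `Hⁿ(s') ∘ Hⁿ(s) = id`. [folklore] -/
theorem semimap_semimap_of_leftInverse {σ' : k' →+* k} (s : A.V →ₛₗ[σ] B.V)
    (hs : ∀ (g : G) (a : A.V), s (A.ρ g a) = B.ρ g (s a)) (s' : B.V →ₛₗ[σ'] A.V)
    (hs' : ∀ (g : G) (b : B.V), s' (B.ρ g b) = A.ρ g (s' b)) (h : ∀ a, s' (s a) = a) (n : ℕ)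
    (x : groupCohomology A n) : semimap s' hs' n (semimap s hs n x) = x := by
  induction x using groupCohomology_induction_on with
  | h z =>
    rw [semimap_π, semimap_π]
    congr 1
    refine iCocycles_injective A n ?_
    rw [iCocycles_cocyclesSemimap, iCocycles_cocyclesSemimap]
    funext g
    rw [cochainsSemimap_apply, cochainsSemimap_apply, h]

/-- A coefficient map with a (semilinear, equivariant) left inverse induces an INJECTIVE map in
cohomology; e.g. `Hⁿ(1 ⊗ σ)` for `σ ∈ Aut(ℂ)` is injective (indeed bijective), so it does not kill
a non-zero eigenclass. [folklore] -/
theorem semimap_injective_of_leftInverse {σ' : k' →+* k} (s : A.V →ₛₗ[σ] B.V)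
    (hs : ∀ (g : G) (a : A.V), s (A.ρ g a) = B.ρ g (s a)) (s' : B.V →ₛₗ[σ'] A.V)
    (hs' : ∀ (g : G) (b : B.V), s' (B.ρ g b) = A.ρ g (s' b)) (h : ∀ a, s' (s a) = a) (n : ℕ) :
    Function.Injective (semimap s hs n) :=
  Function.LeftInverse.injective (g := semimap s' hs' n)
    fun x => semimap_semimap_of_leftInverse s hs s' hs' h n x

/-- A coefficient map with a (semilinear, equivariant) right inverse induces a SURJECTIVE map in
cohomology. [folklore] -/
theorem semimap_surjective_of_rightInverse {σ' : k' →+* k} (s : A.V →ₛₗ[σ] B.V)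
    (hs : ∀ (g : G) (a : A.V), s (A.ρ g a) = B.ρ g (s a)) (s' : B.V →ₛₗ[σ'] A.V)
    (hs' : ∀ (g : G) (b : B.V), s' (B.ρ g b) = A.ρ g (s' b)) (h : ∀ b, s (s' b) = b) (n : ℕ) :
    Function.Surjective (semimap s hs n) :=
  Function.RightInverse.surjective (g := semimap s' hs' n)
    fun y => semimap_semimap_of_leftInverse s' hs' s hs h n y

end Cohomology

/-! ### Naturality with respect to Mathlib's linear functoriality in the coefficients -/

section Naturality

variable {σ : k →+* k'} {A A₂ : Rep k G} {B B₂ : Rep k' G}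

/-- Pointwise formula for Mathlib's `cochainsMap` along the identity of `G`:
`(φ_* x)(g) = φ (x g)`. [folklore] -/
theorem cochainsMap_id_f_apply (φ : A ⟶ A₂) (i : ℕ) (x : (inhomogeneousCochains A).X i)
    (g : Fin i → G) : ((cochainsMap (MonoidHom.id G) φ).f i) x g = φ.hom (x g) :=
  rfl

/-- `i (φ_* z) = φ_* (i z)` for Mathlib's `cocyclesMap` (Mathlib `cyclesMap_i`, pointwise).
[folklore] -/
theorem iCocycles_cocyclesMap_id (φ : A ⟶ A₂) (n : ℕ) (z : cocycles A n) :
    iCocycles A₂ n (cocyclesMap (MonoidHom.id G) φ n z) =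
      ((cochainsMap (MonoidHom.id G) φ).f n) (iCocycles A n z) := by
  have h := LinearMap.congr_fun (congrArg ModuleCat.Hom.hom
    (HomologicalComplex.cyclesMap_i (cochainsMap (MonoidHom.id G) φ) n)) z
  rw [ModuleCat.hom_comp, ModuleCat.hom_comp, LinearMap.comp_apply, LinearMap.comp_apply] at h
  exact h

/-- **Naturality.** If a `σ`-semilinear equivariant `s : A → B` and `s₂ : A₂ → B₂` intertwine a
`k`-linear map of representations `φ : A → A₂` and a `k'`-linear `ψ : B → B₂` (`s₂ ∘ φ = ψ ∘ s`),
then `Hⁿ(s₂) ∘ Hⁿ(φ) = Hⁿ(ψ) ∘ Hⁿ(s)` on `Hⁿ(G, A)`, where `Hⁿ(φ)`, `Hⁿ(ψ)` are Mathlib's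
`groupCohomology.map (MonoidHom.id G)`. (Hecke operators on the cohomology of arithmetic quotients
are such `Hⁿ(φ)`, so a semilinear symmetry of the coefficients commuting with them acts on the
cohomology commuting with them.) [cite: Clozel1990, Thm. 3.13 (proof, §3.5)] -/
theorem semimap_map (s : A.V →ₛₗ[σ] B.V) (hs : ∀ (g : G) (a : A.V), s (A.ρ g a) = B.ρ g (s a))
    (s₂ : A₂.V →ₛₗ[σ] B₂.V) (hs₂ : ∀ (g : G) (a : A₂.V), s₂ (A₂.ρ g a) = B₂.ρ g (s₂ a))
    (φ : A ⟶ A₂) (ψ : B ⟶ B₂) (hcomm : ∀ a : A.V, s₂ (φ.hom a) = ψ.hom (s a)) (n : ℕ)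
    (x : groupCohomology A n) :
    semimap s₂ hs₂ n (map (MonoidHom.id G) φ n x) = map (MonoidHom.id G) ψ n (semimap s hs n x) := by
  induction x using groupCohomology_induction_on with
  | h z =>
    rw [π_map_apply, semimap_π, semimap_π, π_map_apply]
    congr 1
    refine iCocycles_injective B₂ n ?_
    rw [iCocycles_cocyclesSemimap, iCocycles_cocyclesMap_id, iCocycles_cocyclesMap_id,
      iCocycles_cocyclesSemimap]
    funext g
    rw [cochainsSemimap_apply, cochainsMap_id_f_apply, cochainsMap_id_f_apply, hcomm]
    rfl

/-- Naturality, endomorphism form: a `σ`-semilinear equivariant `s : A → B` intertwining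
endomorphisms `φ` of `A` and `ψ` of `B` gives `Hⁿ(s) ∘ Hⁿ(φ) = Hⁿ(ψ) ∘ Hⁿ(s)`; with `A = B`,
`φ = ψ` a Hecke operator: the semilinear symmetry commutes with the Hecke operator on cohomology.
[cite: Clozel1990, Thm. 3.13 (proof, §3.5)] -/
theorem semimap_map_endo (s : A.V →ₛₗ[σ] B.V) (hs : ∀ (g : G) (a : A.V), s (A.ρ g a) = B.ρ g (s a))
    (φ : A ⟶ A) (ψ : B ⟶ B) (hcomm : ∀ a : A.V, s (φ.hom a) = ψ.hom (s a)) (n : ℕ)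
    (x : groupCohomology A n) :
    semimap s hs n (map (MonoidHom.id G) φ n x) = map (MonoidHom.id G) ψ n (semimap s hs n x) :=
  semimap_map s hs s hs φ ψ hcomm n x

end Naturality

end Literature.Algebra.Homology

end
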